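import Literature.Analysis.FluidPDE.AxisymNoSwirlWeightedCoSignedBalance
import Literature.Analysis.FluidPDE.AxisymNoSwirlImpulseWeights
import Literature.Analysis.FluidPDE.AxisymNoSwirlScaleInvariantBounds
import HarnessLib

/-!
# Axisymmetric flows without swirl: the WEIGHTED co-signed flux
# `∫ r²η^±(b) ≤ ∫ r²η^±(0) + ∫₀ᵇ∫ 2(x₀u₀ + x₁u₁) η^±` (Gallay–Šverák 2015, Lemma 5.1 × Lemma 6.4)

Analysis/FluidPDE proof file (theorems only; no definitions, no named facts).  Third step of the
weighted co-signed flux (`AxisymNoSwirlWeightedCoSignedFluxSlice`, `…Balance`): the weighted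
convex balance is specialised to the impulse cut-off weights `g_ε = impulseWeight ε`
(`AxisymNoSwirlImpulseWeights`; for `ε > 0` the weight `r²g_ε` and its drift are bounded,
`uniform_bounds_impulseWeight`) and the convex functionals `βₙ ↑ ψ` are removed by Fatou and
dominated convergence (the datum has `η₀ = ω_θ/r ∈ L¹`, so `‖η(t)‖₁ ≤ ‖η₀‖₁` by the tree's
Lemma 5.1, `IsTaoSolutionOn.lintegral_abs_angVortQuot_le_of_datum`):

* `IsTaoSolutionOn.lintegral_rsq_impulseWeight_comp_angVortQuot_le` — for `ψ` continuous with
  `0 ≤ ψ ≤ |·|`, the pointwise limit of admissible convex `βₙ ≤ ψ` (e.g. `ψ = (·)⁺`, `(·)⁻`), every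
  `ε > 0` and `b ∈ (0, T]`:
  `∫⁻ r²g_ε ψ(Ω(b)) ≤ ofReal (∫ r²g_ε ψ(Ω(0)) + ∫_{t∈(0,b)}∫ ψ(Ω(t)) (D(r²g_ε)[v(t)] + ν div(r²∇g_ε)))`.

* `IsTaoSolutionOn.lintegral_rsq_comp_angVortQuot_le` — the limit `ε → 0` (`r²g_ε ↑ r²`,
  `D(r²g_ε)[v] → 2(x₀v₀ + x₁v₁)`, `div(r²∇g_ε) → 0`, dominated by `3((rη)² + ‖v‖²) + 20ν|η|`,
  `rη = ±‖ω‖`): `∫⁻ r²ψ(Ω(b)) ≤ ∫⁻ r²ψ(η₀) + ofReal (∫_{t∈(0,b)}∫ ψ(Ω(t)) 2(x₀v₀ + x₁v₁))`;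
* `IsTaoSolutionOn.lintegral_rsq_posPart_angVortQuot_le`, `…negPart…` — **THE WEIGHTED
  CO-SIGNED FLUX**: `∫⁻ r²(Ω(b))^± ≤ ∫⁻ r²(η₀)^± + ofReal (∫₀ᵇ∫ (Ω(t))^± · 2(x₀v₀ + x₁v₁))` — the
  impulse carried by each sign of `ω_θ` grows at most by its own transport pairing
  `∫ η^± D(r²)[u] = 2∫ r u_r η^±` (for `η ≥ 0` and `ψ = id` this is the conservation of the
  impulse, Lemma 6.4; the signed control is what bounds the enstrophy `∫|ω|² ≤ ‖η‖_∞ ∫ r²|η|` of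
  ring-plus-dilute-shell data).

WHAT THIS IS NOT: not a statement about blow-up — an a-priori inequality for smooth swirl-free
axisymmetric flows with `ω_θ/r ∈ L¹`.

## Mathlib / tree search

Tree (used): `impulseWeight` and its calculus (`AxisymNoSwirlImpulseWeights`), the weighted
balance `IsTaoSolutionOn.integral_rsq_weight_mul_comp_angVortQuot_le` and
`…integrable_comp_angVortQuot_mul_drift`, `abs_fderiv_rsq_mul_apply_le`
(`AxisymNoSwirlWeightedCoSignedBalance`), `IsTaoSolutionOn.lintegral_abs_angVortQuot_le_of_datum`
(`AxisymNoSwirlCoSignedFlux`), `aestronglyMeasurable_prod_of_continuousOn_off_axis`. Mathlib: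
`lintegral_liminf_le` (Fatou), `tendsto_integral_of_dominated_convergence`, `integral_prod`.
Private copies of the convex-approximant lemmas of `AxisymNoSwirlCoSignedFlux` (private there).

## References

* Th. Gallay, V. Šverák, Confluentes Math. 7 (2015) 67–92 = arXiv:1510.01036, §5 Lemma 5.1,
  §6 Lemma 6.4 (arXiv pp. 16, 19). [GallaySverak2016]
-/

noncomputable section

open MeasureTheory Set Function Filter InnerProductSpace
open _root_.Topology
open scoped NNReal ENNReal RealInnerProductSpace ContDiff

namespace Literature.Analysis.FluidPDE

/-! ### Uniform bounds of the weight `r²g_ε` and its drift for `ε > 0` -/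

section WeightBounds

variable {ε : ℝ}

/-- `r ≤ |x|`. [folklore] -/
private theorem cylRadius_le_norm'' (x : EuclideanSpace ℝ (Fin 3)) : cylRadius x ≤ ‖x‖ :=
  (pow_le_pow_iff_left₀ (cylRadius_nonneg x) (norm_nonneg x) two_ne_zero).1
    (cylRadius_sq_le_norm_sq x)

/-- **`r²g_ε ≤ ε⁻¹`** for `ε > 0` (`ε r² ≤ 1 + ε|x|²`). [cite: GallaySverak2016, §6 proof of Lemma 6.4 (arXiv p. 19); formalization step] -/
theorem abs_rsq_mul_impulseWeight_le_inv (hε : 0 < ε) (x : EuclideanSpace ℝ (Fin 3)) :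
    |cylRadius x ^ 2 * impulseWeight ε x| ≤ ε⁻¹ := by
  have hb := impulseBase_pos hε.le x
  have hr := cylRadius_sq_le_norm_sq x
  rw [abs_of_nonneg (mul_nonneg (sq_nonneg _) (impulseWeight_pos hε.le x).le)]
  calc cylRadius x ^ 2 * impulseWeight ε x ≤ cylRadius x ^ 2 * (1 / (1 + ε * ‖x‖ ^ 2)) :=
        mul_le_mul_of_nonneg_left (impulseWeight_le_one_div hε.le x) (sq_nonneg _)
    _ = cylRadius x ^ 2 / (1 + ε * ‖x‖ ^ 2) := by ring
    _ ≤ ε⁻¹ := by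
        rw [div_le_iff₀ hb]
        have : cylRadius x ^ 2 * ε ≤ 1 + ε * ‖x‖ ^ 2 := by nlinarith [mul_le_mul_of_nonneg_left hr hε.le]
        calc cylRadius x ^ 2 = cylRadius x ^ 2 * ε * ε⁻¹ := by field_simp
          _ ≤ (1 + ε * ‖x‖ ^ 2) * ε⁻¹ := mul_le_mul_of_nonneg_right this (inv_nonneg.2 hε.le)
          _ = ε⁻¹ * (1 + ε * ‖x‖ ^ 2) := mul_comm _ _

/-- **`|xᵢ g_ε| ≤ 1 + ε⁻¹`** for `ε > 0` (`|xᵢ| ≤ 1 + |x|²` and `(1 + |x|²) ≤ (1 + ε⁻¹)(1 + ε|x|²)`).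
[cite: GallaySverak2016, §6 proof of Lemma 6.4 (arXiv p. 19); formalization step] -/
theorem abs_coord_mul_impulseWeight_le (hε : 0 < ε) (i : Fin 3) (x : EuclideanSpace ℝ (Fin 3)) :
    |x i * impulseWeight ε x| ≤ 1 + ε⁻¹ := by
  have hb := impulseBase_pos hε.le x
  have hg0 := (impulseWeight_pos hε.le x).le
  have hxi : |x i| ≤ ‖x‖ := by
    have := PiLp.norm_apply_le x i
    rwa [Real.norm_eq_abs] at this
  have h1 : |x i| ≤ 1 + ‖x‖ ^ 2 := hxi.trans (by nlinarith [norm_nonneg x, sq_nonneg (‖x‖ - 1)])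
  rw [abs_mul, abs_of_nonneg hg0]
  calc |x i| * impulseWeight ε x ≤ (1 + ‖x‖ ^ 2) * (1 / (1 + ε * ‖x‖ ^ 2)) :=
        mul_le_mul h1 (impulseWeight_le_one_div hε.le x) hg0 (by positivity)
    _ = (1 + ‖x‖ ^ 2) / (1 + ε * ‖x‖ ^ 2) := by ring
    _ ≤ 1 + ε⁻¹ := by
        rw [div_le_iff₀ hb]
        have h2 : (1 + ε⁻¹) * (1 + ε * ‖x‖ ^ 2) = 1 + ε * ‖x‖ ^ 2 + ε⁻¹ + ‖x‖ ^ 2 := by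
          field_simp
          ring
        rw [h2]
        nlinarith [mul_nonneg hε.le (sq_nonneg ‖x‖), inv_nonneg.2 hε.le]

/-- **`|r² Dg_ε(x)[w]| ≤ 4(1 + ε⁻¹)‖w‖`** for `ε > 0` (`ε|x|³ ≤ ε|x|² + ε|x|⁴ ≤ (1 + ε⁻¹)(1 + ε|x|²)³`).
[cite: GallaySverak2016, §6 proof of Lemma 6.4 (arXiv p. 19); formalization step] -/
theorem abs_rsq_mul_fderiv_impulseWeight_le_const (hε : 0 < ε) (x w : EuclideanSpace ℝ (Fin 3)) :
    |cylRadius x ^ 2 * fderiv ℝ (impulseWeight ε) x w| ≤ 4 * (1 + ε⁻¹) * ‖w‖ := by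
  rw [fderiv_impulseWeight_apply hε.le]
  have hb := impulseBase_pos hε.le x
  have hr := cylRadius_sq_le_norm_sq x
  have hxw : |⟪x, w⟫| ≤ ‖x‖ * ‖w‖ := abs_real_inner_le_norm x w
  rw [← mul_div_assoc, abs_div, abs_of_pos (pow_pos hb 3), div_le_iff₀ (pow_pos hb 3), abs_mul,
    abs_of_nonneg (sq_nonneg _), abs_mul, abs_neg, abs_of_nonneg (by positivity : 0 ≤ 4 * ε)]
  have hn := norm_nonneg x
  have hw := norm_nonneg w
  -- `ε |x|³ ≤ (1 + ε⁻¹)(1 + ε|x|²)³`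
  have h3 : ‖x‖ ^ 3 ≤ ‖x‖ ^ 2 + ‖x‖ ^ 4 := by nlinarith [sq_nonneg (‖x‖ - 1), sq_nonneg ‖x‖, hn]
  have hkey : ε * ‖x‖ ^ 3 ≤ (1 + ε⁻¹) * (1 + ε * ‖x‖ ^ 2) ^ 3 := by
    have e4 : ε * ‖x‖ ^ 4 = ε⁻¹ * (ε * ‖x‖ ^ 2) ^ 2 := by field_simp
    have h13 : (1 + ε * ‖x‖ ^ 2) ≤ (1 + ε * ‖x‖ ^ 2) ^ 3 :=
      le_self_pow₀ (one_le_impulseBase hε.le x) (by norm_num)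
    have h23 : (1 + ε * ‖x‖ ^ 2) ^ 2 ≤ (1 + ε * ‖x‖ ^ 2) ^ 3 :=
      pow_le_pow_right₀ (one_le_impulseBase hε.le x) (by norm_num)
    have hsq : (ε * ‖x‖ ^ 2) ^ 2 ≤ (1 + ε * ‖x‖ ^ 2) ^ 2 :=
      pow_le_pow_left₀ (by positivity) (by linarith) 2
    calc ε * ‖x‖ ^ 3 ≤ ε * (‖x‖ ^ 2 + ‖x‖ ^ 4) := mul_le_mul_of_nonneg_left h3 hε.le
      _ = ε * ‖x‖ ^ 2 + ε⁻¹ * (ε * ‖x‖ ^ 2) ^ 2 := by rw [mul_add, e4]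
      _ ≤ (1 + ε * ‖x‖ ^ 2) ^ 3 + ε⁻¹ * (1 + ε * ‖x‖ ^ 2) ^ 3 := by
          refine add_le_add ((le_add_of_nonneg_left zero_le_one).trans h13) ?_
          exact mul_le_mul_of_nonneg_left (hsq.trans h23) (inv_nonneg.2 hε.le)
      _ = (1 + ε⁻¹) * (1 + ε * ‖x‖ ^ 2) ^ 3 := by ring
  calc cylRadius x ^ 2 * (4 * ε * |⟪x, w⟫|)
      ≤ ‖x‖ ^ 2 * (4 * ε * (‖x‖ * ‖w‖)) := by gcongr
    _ = 4 * ‖w‖ * (ε * ‖x‖ ^ 3) := by ring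
    _ ≤ 4 * ‖w‖ * ((1 + ε⁻¹) * (1 + ε * ‖x‖ ^ 2) ^ 3) :=
        mul_le_mul_of_nonneg_left hkey (by positivity)
    _ = 4 * (1 + ε⁻¹) * ‖w‖ * (1 + ε * ‖x‖ ^ 2) ^ 3 := by ring

/-- **The uniform bounds of the cut-off weight** `g_ε`, `ε > 0`, in the form consumed by the
weighted balance: with `C_ε = 25 + 5ε⁻¹`, `|r²g_ε|, |x₀g_ε|, |x₁g_ε|, |r²∂ᵢg_ε|, |div(r²∇g_ε)| ≤ C_ε`,
and `g_ε ≥ 0`. [cite: GallaySverak2016, §6 proof of Lemma 6.4 (arXiv p. 19); formalization step] -/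
theorem uniform_bounds_impulseWeight (hε : 0 < ε) :
    (∀ x : EuclideanSpace ℝ (Fin 3), 0 ≤ impulseWeight ε x) ∧
    (∀ x : EuclideanSpace ℝ (Fin 3), |cylRadius x ^ 2 * impulseWeight ε x| ≤ 25 + 5 * ε⁻¹) ∧
    (∀ x : EuclideanSpace ℝ (Fin 3), |x 0 * impulseWeight ε x| ≤ 25 + 5 * ε⁻¹) ∧
    (∀ x : EuclideanSpace ℝ (Fin 3), |x 1 * impulseWeight ε x| ≤ 25 + 5 * ε⁻¹) ∧
    (∀ (i : Fin 3) (x : EuclideanSpace ℝ (Fin 3)),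
      |cylRadius x ^ 2 * fderiv ℝ (impulseWeight ε) x (EuclideanSpace.single i 1)| ≤ 25 + 5 * ε⁻¹) ∧
    (∀ x : EuclideanSpace ℝ (Fin 3), |VectorCalculus.divergence
      (fun y => (cylRadius y ^ 2) • gradient (impulseWeight ε) y) x| ≤ 25 + 5 * ε⁻¹) := by
  have hi : 0 ≤ ε⁻¹ := inv_nonneg.2 hε.le
  refine ⟨fun x => (impulseWeight_pos hε.le x).le, fun x => ?_, fun x => ?_, fun x => ?_,
    fun i x => ?_, fun x => ?_⟩
  · exact (abs_rsq_mul_impulseWeight_le_inv hε x).trans (by linarith)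
  · exact (abs_coord_mul_impulseWeight_le hε 0 x).trans (by linarith)
  · exact (abs_coord_mul_impulseWeight_le hε 1 x).trans (by linarith)
  · refine (abs_rsq_mul_fderiv_impulseWeight_le_const hε x _).trans ?_
    rw [PiLp.norm_single, norm_one, mul_one]
    linarith
  · exact (abs_divergence_rsq_gradient_impulseWeight_le hε.le x).trans (by linarith)

end WeightBounds

/-! ### Convex approximants (private copies of the elementary facts) -/

section Convex

variable {β : ℝ → ℝ} {K : ℝ}

/-- For `β ∈ C²`: `β` and `β'` are differentiable. [folklore] -/
private theorem differentiable_deriv_of_contDiff_two₃ (hβ : ContDiff ℝ 2 β) :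
    Differentiable ℝ β ∧ Differentiable ℝ (deriv β) := by
  refine ⟨hβ.differentiable (by norm_num), ?_⟩
  have h1 : ContDiff ℝ 1 (deriv β) := ContDiff.deriv' (n := 1) (by exact_mod_cast hβ)
  exact h1.differentiable one_ne_zero

/-- If `β(0) = β'(0) = 0` and `β'' ≥ 0` then `β ≥ 0`. [folklore] -/
private theorem nonneg_of_deriv2_nonneg₃ (hβ : ContDiff ℝ 2 β) (h00 : β 0 = 0) (h0 : deriv β 0 = 0)
    (hnn : ∀ v, 0 ≤ deriv (deriv β) v) (v : ℝ) : 0 ≤ β v := by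
  obtain ⟨hd, hd'⟩ := differentiable_deriv_of_contDiff_two₃ hβ
  have hmono : Monotone (deriv β) := monotone_of_deriv_nonneg hd' hnn
  rcases le_total 0 v with hv | hv
  · have hm : MonotoneOn β (Ici 0) :=
      monotoneOn_of_deriv_nonneg (convex_Ici 0) hd.continuous.continuousOn
        (hd.differentiableOn.mono interior_subset) fun x hx => by
          rw [interior_Ici] at hx
          have := hmono hx.le
          rwa [h0] at this
    have := hm (self_mem_Ici (a := (0 : ℝ))) (show v ∈ Ici (0 : ℝ) from hv) hv
    rwa [h00] at this
  · have hm : AntitoneOn β (Iic 0) :=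
      antitoneOn_of_deriv_nonpos (convex_Iic 0) hd.continuous.continuousOn
        (hd.differentiableOn.mono interior_subset) fun x hx => by
          rw [interior_Iic] at hx
          have := hmono hx.le
          rwa [h0] at this
    have := hm (show v ∈ Iic (0 : ℝ) from hv) (self_mem_Iic (a := (0 : ℝ))) hv
    rwa [h00] at this

end Convex

/-! ### `L¹` data along the solution from an `L¹` datum -/

section Data

variable {T ν : ℝ} {u₀ : EuclideanSpace ℝ (Fin 3) → EuclideanSpace ℝ (Fin 3)}
  {v : ℝ → EuclideanSpace ℝ (Fin 3) → EuclideanSpace ℝ (Fin 3)}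
  {q : ℝ → EuclideanSpace ℝ (Fin 3) → ℝ}

/-- Along a Tao-class solution (`0 < ν`, `0 < T`) from an axisymmetric swirl-free datum with
`η₀ = ω_θ/r ∈ L¹`: every slice `Ω(t) = angVortQuot (v t)` is integrable with
`∫ |Ω(t)| ≤ ∫ |η₀|` (Gallay–Šverák Lemma 5.1, tree theorem). [cite: GallaySverak2016, §5 Lemma 5.1 (arXiv p. 16)] -/
theorem IsTaoSolutionOn.integrable_angVortQuot_of_datum (h : IsTaoSolutionOn T ν u₀ v q)
    (hT : 0 < T) (hν : 0 < ν) (h0 : IsAxisymmetric u₀) (h0' : HasNoSwirl u₀)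
    (hL1 : Integrable (angVortQuot u₀)) {t : ℝ} (ht : t ∈ Icc 0 T) :
    Integrable (angVortQuot (v t)) ∧
      ∫⁻ x, ‖angVortQuot (v t) x‖ₑ ≤ ∫⁻ x, ‖angVortQuot u₀ x‖ₑ := by
  have h0T : (0 : ℝ) ∈ Icc 0 T := ⟨le_rfl, hT.le⟩
  have hle : ∫⁻ x, ‖angVortQuot (v t) x‖ₑ ≤ ∫⁻ x, ‖angVortQuot u₀ x‖ₑ := by
    have := h.lintegral_abs_angVortQuot_le_of_datum hT hν h0 h0' h0T ht ht.1
    rwa [h.initial] at this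
  have hc : Continuous (angVortQuot (v t)) :=
    (contDiff_angVortQuot (n := 0) (by
      exact_mod_cast (h.classical.contDiff_velocity ht).of_le (by norm_cast))).continuous
  exact ⟨⟨hc.aestronglyMeasurable, lt_of_le_of_lt hle hL1.hasFiniteIntegral⟩, hle⟩

/-- The space-time function `(t, x) ↦ |Ω(t, x)|` is integrable on `(0, b) × ℝ³` (`b ≤ T`) when
`η₀ ∈ L¹`, with the slice bound of Lemma 5.1. [cite: GallaySverak2016, §5 Lemma 5.1 (arXiv p. 16); formalization step] -/
theorem IsTaoSolutionOn.integrable_prod_abs_angVortQuot (h : IsTaoSolutionOn T ν u₀ v q)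
    (hT : 0 < T) (hν : 0 < ν) (h0 : IsAxisymmetric u₀) (h0' : HasNoSwirl u₀)
    (hL1 : Integrable (angVortQuot u₀)) {b : ℝ} (hb : b ∈ Ioc 0 T) :
    Integrable (uncurry fun t x => |angVortQuot (v t) x|) ((volume.restrict (Ioo 0 b)).prod volume) := by
  have hU : UniqueDiffOn ℝ (Icc 0 T) := uniqueDiffOn_Icc hT
  have hsm : IsSmoothSpaceTimeOn (Icc 0 T) v := h.classical.smooth_velocity
  have hΩ : IsSmoothSpaceTimeOn (Icc 0 T) (fun t => angVortQuot (v t)) :=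
    hsm.angVortQuot_family (convex_Icc 0 T) hU
  refine ⟨?_, ?_⟩
  · refine aestronglyMeasurable_prod_of_continuousOn_off_axis ?_
    have hsub : Ioo 0 b ×ˢ {x : EuclideanSpace ℝ (Fin 3) | cylRadius x ≠ 0} ⊆ Icc 0 T ×ˢ univ :=
      prod_mono (fun t ht => ⟨ht.1.le, ht.2.le.trans hb.2⟩) (subset_univ _)
    exact (continuous_abs.comp_continuousOn hΩ.continuousOn).mono hsub
  · have hle := lintegral_prod_le (μ := volume.restrict (Ioo 0 b))
      (ν := (volume : Measure (EuclideanSpace ℝ (Fin 3))))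
      (fun z : ℝ × EuclideanSpace ℝ (Fin 3) => ‖uncurry (fun t x => |angVortQuot (v t) x|) z‖ₑ)
    refine lt_of_le_of_lt hle ?_
    calc ∫⁻ t in Ioo 0 b, ∫⁻ x, ‖uncurry (fun t x => |angVortQuot (v t) x|) (t, x)‖ₑ
        ≤ ∫⁻ _ in Ioo 0 b, ∫⁻ x, ‖angVortQuot u₀ x‖ₑ := by
          refine setLIntegral_mono' measurableSet_Ioo fun t ht => ?_
          have htI : t ∈ Icc 0 T := ⟨ht.1.le, ht.2.le.trans hb.2⟩
          refine le_trans (le_of_eq (lintegral_congr fun x => ?_))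
            (h.integrable_angVortQuot_of_datum hT hν h0 h0' hL1 htI).2
          simp only [uncurry_apply_pair]
          rw [Real.enorm_eq_ofReal_abs, abs_abs, ← Real.enorm_eq_ofReal_abs]
      _ < ⊤ := by
          rw [setLIntegral_const]
          exact ENNReal.mul_lt_top hL1.hasFiniteIntegral (by simp)

end Data

/-! ### Removing the convex approximants at fixed `ε > 0` -/

section FixedWeight

variable {T ν : ℝ} {u₀ : EuclideanSpace ℝ (Fin 3) → EuclideanSpace ℝ (Fin 3)}
  {v : ℝ → EuclideanSpace ℝ (Fin 3) → EuclideanSpace ℝ (Fin 3)}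
  {q : ℝ → EuclideanSpace ℝ (Fin 3) → ℝ}

/-- **The weighted balance for the limit functional `ψ`** (Fatou in the approximants).  Let
`(v, q)` be a Tao-class solution on `[0, T]` (`0 < ν`, `0 < T`) from an axisymmetric swirl-free
datum with `η₀ ∈ L¹`, `Ω(t) = angVortQuot (v t)`; let `ψ` be continuous with `0 ≤ ψ ≤ |·|` and the
pointwise limit of admissible convex `βₙ ≤ ψ` (`βₙ ∈ C²`, `βₙ(0) = βₙ'(0) = 0`, `0 ≤ βₙ'' ≤ Kₙ`);
let `ε > 0` and `b ∈ (0, T]`.  Then, with `g_ε = impulseWeight ε`,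
`∫⁻ r²g_ε ψ(Ω(b)) ≤ ofReal (∫ r²g_ε ψ(Ω(0)) + ∫_{t∈(0,b)}∫ ψ(Ω(t)) (D(r²g_ε)[v(t)] + ν div(r²∇g_ε)))`.
[cite: GallaySverak2016, §5 Lemma 5.1 and §6 Lemma 6.4 (arXiv pp. 16, 19)] -/
theorem IsTaoSolutionOn.lintegral_rsq_impulseWeight_comp_angVortQuot_le (h : IsTaoSolutionOn T ν u₀ v q)
    (hT : 0 < T) (hν : 0 < ν) (h0 : IsAxisymmetric u₀) (h0' : HasNoSwirl u₀)
    (hL1 : Integrable (angVortQuot u₀))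
    {ψ : ℝ → ℝ} {βs : ℕ → ℝ → ℝ} {Ks : ℕ → ℝ} (hψc : Continuous ψ) (hψ0 : ∀ w, 0 ≤ ψ w)
    (hψle : ∀ w, ψ w ≤ |w|)
    (hβ : ∀ n, ContDiff ℝ 2 (βs n)) (h00 : ∀ n, βs n 0 = 0) (hd0 : ∀ n, deriv (βs n) 0 = 0)
    (hnn : ∀ n w, 0 ≤ deriv (deriv (βs n)) w) (hK : ∀ n w, deriv (deriv (βs n)) w ≤ Ks n)
    (hle : ∀ n w, βs n w ≤ ψ w) (hlim : ∀ w, Tendsto (fun n => βs n w) atTop (𝓝 (ψ w)))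
    {ε : ℝ} (hε : 0 < ε) {b : ℝ} (hb : b ∈ Ioc 0 T) :
    ∫⁻ x, ENNReal.ofReal (cylRadius x ^ 2 * impulseWeight ε x * ψ (angVortQuot (v b) x)) ≤
      ENNReal.ofReal ((∫ x, cylRadius x ^ 2 * impulseWeight ε x * ψ (angVortQuot (v 0) x)) +
        ∫ t in Ioo 0 b, ∫ x, ψ (angVortQuot (v t) x) *
          (fderiv ℝ (fun y => cylRadius y ^ 2 * impulseWeight ε y) x (v t x) +
            ν * VectorCalculus.divergence
              (fun y => (cylRadius y ^ 2) • gradient (impulseWeight ε) y) x)) := by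
  have hU : UniqueDiffOn ℝ (Icc 0 T) := uniqueDiffOn_Icc hT
  have hsm : IsSmoothSpaceTimeOn (Icc 0 T) v := h.classical.smooth_velocity
  have hax : ∀ s ∈ Icc 0 T, IsAxisymmetric (v s) := h.isAxisymmetric hν hT h0
  have hbT : b ∈ Icc 0 T := ⟨hb.1.le, hb.2⟩
  have h0T : (0 : ℝ) ∈ Icc 0 T := ⟨le_rfl, hT.le⟩
  obtain ⟨hg0, hgr, hgx0, hgx1, hgD, hgdiv⟩ := uniform_bounds_impulseWeight hε
  set Cg : ℝ := 25 + 5 * ε⁻¹ with hCgdef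
  have hCg0 : 0 ≤ Cg := by rw [hCgdef]; positivity
  have hg2 : ContDiff ℝ 2 (impulseWeight ε) := contDiff_impulseWeight hε.le
  have hg1 : ContDiff ℝ 1 (impulseWeight ε) := contDiff_impulseWeight hε.le
  have hK' : ∀ n w, |deriv (deriv (βs n)) w| ≤ Ks n := fun n w => by
    rw [abs_of_nonneg (hnn n w)]; exact hK n w
  have hβnn : ∀ n w, 0 ≤ βs n w := fun n => nonneg_of_deriv2_nonneg₃ (hβ n) (h00 n) (hd0 n) (hnn n)
  have hβabs : ∀ n w, |βs n w| ≤ |w| := fun n w => by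
    rw [abs_of_nonneg (hβnn n w)]; exact (hle n w).trans (hψle w)
  have hψabs : ∀ w, |ψ w| ≤ |w| := fun w => by rw [abs_of_nonneg (hψ0 w)]; exact hψle w
  have hΩc : ∀ t ∈ Icc 0 T, Continuous (angVortQuot (v t)) := fun t ht =>
    (contDiff_angVortQuot (n := 0) (by
      exact_mod_cast (h.classical.contDiff_velocity ht).of_le (by norm_cast))).continuous
  have hΩ : IsSmoothSpaceTimeOn (Icc 0 T) (fun t => angVortQuot (v t)) :=
    hsm.angVortQuot_family (convex_Icc 0 T) hU
  obtain ⟨B, hB0, hB⟩ := h.exists_bound_velocity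
  -- the weight `φ = r² g_ε` and the multiplier `F`
  set φ : EuclideanSpace ℝ (Fin 3) → ℝ := fun y => cylRadius y ^ 2 * impulseWeight ε y with hφdef
  have hφc : Continuous φ := (continuous_cylRadius.pow 2).mul hg1.continuous
  have hr2 : ContDiff ℝ 1 fun y : EuclideanSpace ℝ (Fin 3) => cylRadius y ^ 2 := by
    have : (fun y : EuclideanSpace ℝ (Fin 3) => cylRadius y ^ 2) = fun y => y 0 ^ 2 + y 1 ^ 2 :=
      funext cylRadius_sq
    rw [this]; fun_prop
  have hφ1 : ContDiff ℝ 1 φ := hr2.mul hg1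
  set F : ℝ → EuclideanSpace ℝ (Fin 3) → ℝ := fun t x => fderiv ℝ φ x (v t x) +
    ν * VectorCalculus.divergence (fun y => (cylRadius y ^ 2) • gradient (impulseWeight ε) y) x
    with hFdef
  set L : ℝ := 7 * B * Cg + |ν| * Cg with hLdef
  have hL0 : 0 ≤ L := by positivity
  have hFb : ∀ t ∈ Icc 0 T, ∀ x, |F t x| ≤ L := by
    intro t ht x
    have h1 := abs_fderiv_rsq_mul_apply_le (hg1.differentiable one_ne_zero) hgx0 hgx1 hgD (hB t ht x) x
    have h2 : |ν * VectorCalculus.divergence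
        (fun y => (cylRadius y ^ 2) • gradient (impulseWeight ε) y) x| ≤ |ν| * Cg := by
      rw [abs_mul]; exact mul_le_mul_of_nonneg_left (hgdiv x) (abs_nonneg _)
    exact (abs_add_le _ _).trans (add_le_add h1 h2)
  -- continuity of `F` on `[0,T] × ℝ³`
  have hdivc : Continuous fun x => VectorCalculus.divergence
      (fun y => (cylRadius y ^ 2) • gradient (impulseWeight ε) y) x :=
    continuous_divergence_rsq_gradient_impulseWeight hε.le
  have hFc : ContinuousOn (uncurry F) (Icc 0 T ×ˢ univ) := by
    have c2 : ContinuousOn (fun p : ℝ × EuclideanSpace ℝ (Fin 3) => fderiv ℝ φ p.2 (v p.1 p.2))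
        (Icc 0 T ×ˢ univ) :=
      ((hφ1.continuous_fderiv one_ne_zero).comp_continuousOn continuous_snd.continuousOn).clm_apply
        hsm.continuousOn
    have c3 : ContinuousOn (fun p : ℝ × EuclideanSpace ℝ (Fin 3) => ν * VectorCalculus.divergence
        (fun y => (cylRadius y ^ 2) • gradient (impulseWeight ε) y) p.2) (Icc 0 T ×ˢ univ) :=
      (continuous_const.mul (hdivc.comp continuous_snd)).continuousOn
    exact c2.add c3
  -- (E_n): the weighted convex balance for each approximant
  have hEn : ∀ n, ∫ x, φ x * βs n (angVortQuot (v b) x) ≤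
      (∫ x, φ x * βs n (angVortQuot (v 0) x)) +
        ∫ t in Ioo 0 b, ∫ x, βs n (angVortQuot (v t) x) * F t x := by
    intro n
    have := h.integral_rsq_weight_mul_comp_angVortQuot_le hT hν h0 h0' (hβ n) (h00 n) (hd0 n) (hnn n)
      (hK' n) hg2 hg0 hgr hgx0 hgx1 hgD hgdiv hb
    simpa only [hφdef, hFdef] using this
  -- integrability of the weighted slices
  have hslice_int : ∀ n, ∀ t ∈ Icc 0 T, Integrable (fun x => φ x * βs n (angVortQuot (v t) x)) := by
    intro n t ht
    obtain ⟨hΩi, -⟩ := h.integrable_angVortQuot_of_datum hT hν h0 h0' hL1 ht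
    have h1 : Integrable (fun x => βs n (angVortQuot (v t) x)) :=
      hΩi.norm.mono' (((hβ n).continuous.comp (hΩc t ht)).aestronglyMeasurable)
        (ae_of_all _ fun x => by rw [Real.norm_eq_abs, Real.norm_eq_abs]; exact hβabs n _)
    exact h1.bdd_mul hφc.aestronglyMeasurable (ae_of_all _ fun x => by
      rw [Real.norm_eq_abs]; exact hgr x)
  -- Fatou on the left-hand side
  have hmeas : ∀ n, Measurable fun x => ENNReal.ofReal (φ x * βs n (angVortQuot (v b) x)) := fun n =>
    (hφc.mul ((hβ n).continuous.comp (hΩc b hbT))).measurable.ennreal_ofReal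
  have hlimL : ∀ x, Tendsto (fun n => ENNReal.ofReal (φ x * βs n (angVortQuot (v b) x))) atTop
      (𝓝 (ENNReal.ofReal (φ x * ψ (angVortQuot (v b) x)))) := fun x =>
    (ENNReal.continuous_ofReal.tendsto _).comp ((hlim _).const_mul (φ x))
  have hFatou : ∫⁻ x, ENNReal.ofReal (φ x * ψ (angVortQuot (v b) x)) ≤
      liminf (fun n => ∫⁻ x, ENNReal.ofReal (φ x * βs n (angVortQuot (v b) x))) atTop := by
    calc ∫⁻ x, ENNReal.ofReal (φ x * ψ (angVortQuot (v b) x))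
        = ∫⁻ x, liminf (fun n => ENNReal.ofReal (φ x * βs n (angVortQuot (v b) x))) atTop :=
          lintegral_congr fun x => ((hlimL x).liminf_eq).symm
      _ ≤ _ := lintegral_liminf_le hmeas
  -- the left-hand sides as real integrals, bounded by (E_n)
  have hφnn : ∀ x, 0 ≤ φ x := fun x => mul_nonneg (sq_nonneg _) (hg0 x)
  have hLn : ∀ n, ∫⁻ x, ENNReal.ofReal (φ x * βs n (angVortQuot (v b) x)) ≤
      ENNReal.ofReal ((∫ x, φ x * βs n (angVortQuot (v 0) x)) +
        ∫ t in Ioo 0 b, ∫ x, βs n (angVortQuot (v t) x) * F t x) := by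
    intro n
    rw [← ofReal_integral_eq_lintegral_ofReal (hslice_int n b hbT)
      (ae_of_all _ fun x => mul_nonneg (hφnn x) (hβnn n _))]
    exact ENNReal.ofReal_le_ofReal (hEn n)
  -- dominated convergence of the initial term
  obtain ⟨hΩ0i, -⟩ := h.integrable_angVortQuot_of_datum hT hν h0 h0' hL1 h0T
  have hA : Tendsto (fun n => ∫ x, φ x * βs n (angVortQuot (v 0) x)) atTop
      (𝓝 (∫ x, φ x * ψ (angVortQuot (v 0) x))) := by
    refine tendsto_integral_of_dominated_convergence (fun x => Cg * |angVortQuot (v 0) x|)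
      (fun n => (hφc.mul ((hβ n).continuous.comp (hΩc 0 h0T))).aestronglyMeasurable)
      (hΩ0i.norm.const_mul Cg |>.congr (ae_of_all _ fun x => by simp [Real.norm_eq_abs]))
      (fun n => ae_of_all _ fun x => ?_) (ae_of_all _ fun x => (hlim _).const_mul (φ x))
    rw [Real.norm_eq_abs, abs_mul]
    exact mul_le_mul (hgr x) (hβabs n _) (abs_nonneg _) hCg0
  -- dominated convergence of the space-time term (product measure)
  set μb : Measure (ℝ × EuclideanSpace ℝ (Fin 3)) := (volume.restrict (Ioo 0 b)).prod volume with hμb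
  have hsub : Ioo 0 b ×ˢ {x : EuclideanSpace ℝ (Fin 3) | cylRadius x ≠ 0} ⊆ Icc 0 T ×ˢ univ :=
    prod_mono (fun t ht => ⟨ht.1.le, ht.2.le.trans hb.2⟩) (subset_univ _)
  have hGn_meas : ∀ n, AEStronglyMeasurable (uncurry fun t x => βs n (angVortQuot (v t) x) * F t x) μb := by
    intro n
    refine aestronglyMeasurable_prod_of_continuousOn_off_axis ?_
    exact (((hβ n).continuous.comp_continuousOn hΩ.continuousOn).mul hFc).mono hsub
  have hG_meas : AEStronglyMeasurable (uncurry fun t x => ψ (angVortQuot (v t) x) * F t x) μb := by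
    refine aestronglyMeasurable_prod_of_continuousOn_off_axis ?_
    exact ((hψc.comp_continuousOn hΩ.continuousOn).mul hFc).mono hsub
  have hDom : Integrable (uncurry fun t x => L * |angVortQuot (v t) x|) μb := by
    have := (h.integrable_prod_abs_angVortQuot hT hν h0 h0' hL1 hb).const_mul L
    exact this
  -- the time variable lies in `(0, b)` almost everywhere for `μb`
  have hS : ∀ᵐ z ∂μb, z.1 ∈ Ioo 0 b := by
    rw [ae_iff]
    have e : {z : ℝ × EuclideanSpace ℝ (Fin 3) | ¬ z.1 ∈ Ioo 0 b} = (Ioo 0 b)ᶜ ×ˢ univ := by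
      ext z; simp [mem_prod]
    rw [e, hμb, Measure.prod_prod, Measure.restrict_apply (measurableSet_Ioo.compl),
      compl_inter_self, measure_empty, zero_mul]
  have hGn_bound : ∀ n, ∀ᵐ z ∂μb, ‖uncurry (fun t x => βs n (angVortQuot (v t) x) * F t x) z‖ ≤
      uncurry (fun t x => L * |angVortQuot (v t) x|) z := by
    intro n
    filter_upwards [hS] with z hz
    obtain ⟨t, x⟩ := z
    have htI : t ∈ Icc 0 T := ⟨hz.1.le, hz.2.le.trans hb.2⟩
    simp only [uncurry_apply_pair, Real.norm_eq_abs, abs_mul]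
    calc |βs n (angVortQuot (v t) x)| * |F t x| ≤ |angVortQuot (v t) x| * L :=
          mul_le_mul (hβabs n _) (hFb t htI x) (abs_nonneg _) (abs_nonneg _)
      _ = L * |angVortQuot (v t) x| := mul_comm _ _
  have hG_bound : ∀ᵐ z ∂μb, ‖uncurry (fun t x => ψ (angVortQuot (v t) x) * F t x) z‖ ≤
      uncurry (fun t x => L * |angVortQuot (v t) x|) z := by
    filter_upwards [hS] with z hz
    obtain ⟨t, x⟩ := z
    have htI : t ∈ Icc 0 T := ⟨hz.1.le, hz.2.le.trans hb.2⟩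
    simp only [uncurry_apply_pair, Real.norm_eq_abs, abs_mul]
    calc |ψ (angVortQuot (v t) x)| * |F t x| ≤ |angVortQuot (v t) x| * L :=
          mul_le_mul (hψabs _) (hFb t htI x) (abs_nonneg _) (abs_nonneg _)
      _ = L * |angVortQuot (v t) x| := mul_comm _ _
  have hG_lim : ∀ᵐ z ∂μb, Tendsto (fun n => uncurry (fun t x => βs n (angVortQuot (v t) x) * F t x) z)
      atTop (𝓝 (uncurry (fun t x => ψ (angVortQuot (v t) x) * F t x) z)) :=
    ae_of_all _ fun z => (hlim _).mul_const _
  have hItend : Tendsto (fun n => ∫ z, uncurry (fun t x => βs n (angVortQuot (v t) x) * F t x) z ∂μb)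
      atTop (𝓝 (∫ z, uncurry (fun t x => ψ (angVortQuot (v t) x) * F t x) z ∂μb)) :=
    tendsto_integral_of_dominated_convergence _ hGn_meas hDom hGn_bound hG_lim
  -- Fubini
  have hGn_int : ∀ n, Integrable (uncurry fun t x => βs n (angVortQuot (v t) x) * F t x) μb :=
    fun n => hDom.mono' (hGn_meas n) (hGn_bound n)
  have hG_int : Integrable (uncurry fun t x => ψ (angVortQuot (v t) x) * F t x) μb :=
    hDom.mono' hG_meas hG_bound
  have hIn_eq : ∀ n, ∫ z, uncurry (fun t x => βs n (angVortQuot (v t) x) * F t x) z ∂μb =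
      ∫ t in Ioo 0 b, ∫ x, βs n (angVortQuot (v t) x) * F t x := fun n => by
    rw [hμb, integral_prod _ (hGn_int n)]
    rfl
  have hI_eq : ∫ z, uncurry (fun t x => ψ (angVortQuot (v t) x) * F t x) z ∂μb =
      ∫ t in Ioo 0 b, ∫ x, ψ (angVortQuot (v t) x) * F t x := by
    rw [hμb, integral_prod _ hG_int]
    rfl
  have hI : Tendsto (fun n => ∫ t in Ioo 0 b, ∫ x, βs n (angVortQuot (v t) x) * F t x) atTop
      (𝓝 (∫ t in Ioo 0 b, ∫ x, ψ (angVortQuot (v t) x) * F t x)) := by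
    rw [← hI_eq]
    simp_rw [← hIn_eq]
    exact hItend
  -- combine
  have hsum := (ENNReal.continuous_ofReal.tendsto _).comp (hA.add hI)
  calc ∫⁻ x, ENNReal.ofReal (φ x * ψ (angVortQuot (v b) x))
      ≤ liminf (fun n => ∫⁻ x, ENNReal.ofReal (φ x * βs n (angVortQuot (v b) x))) atTop := hFatou
    _ ≤ liminf (fun n => ENNReal.ofReal ((∫ x, φ x * βs n (angVortQuot (v 0) x)) +
          ∫ t in Ioo 0 b, ∫ x, βs n (angVortQuot (v t) x) * F t x)) atTop :=
        liminf_le_liminf (Eventually.of_forall hLn)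
    _ = ENNReal.ofReal ((∫ x, φ x * ψ (angVortQuot (v 0) x)) +
          ∫ t in Ioo 0 b, ∫ x, ψ (angVortQuot (v t) x) * F t x) := hsum.liminf_eq

end FixedWeight

/-! ### The limit `ε → 0`: the weighted co-signed flux -/

section Limit

variable {T ν : ℝ} {u₀ : EuclideanSpace ℝ (Fin 3) → EuclideanSpace ℝ (Fin 3)}
  {v : ℝ → EuclideanSpace ℝ (Fin 3) → EuclideanSpace ℝ (Fin 3)}
  {q : ℝ → EuclideanSpace ℝ (Fin 3) → ℝ}

/-- Cauchy–Schwarz in the horizontal plane: `|x₀w₀ + x₁w₁| ≤ r(x) ‖w‖` (the tree's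
`abs_horizontal_inner_le` with `r = cylRadius`). [folklore] -/
private theorem abs_horizontal_inner_le_rad (x w : EuclideanSpace ℝ (Fin 3)) :
    |x 0 * w 0 + x 1 * w 1| ≤ cylRadius x * ‖w‖ :=
  abs_horizontal_inner_le x w

/-- Product rule for the weight `φ = r² g` (private copy):
`D(r²g)(x)[w] = 2(x₀w₀ + x₁w₁) g(x) + r² Dg(x)[w]`. [folklore] -/
private theorem fderiv_cylRadius_sq_mul_apply₃ {g : EuclideanSpace ℝ (Fin 3) → ℝ}
    (hg : Differentiable ℝ g) (x w : EuclideanSpace ℝ (Fin 3)) :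
    fderiv ℝ (fun y => cylRadius y ^ 2 * g y) x w =
      2 * (x 0 * w 0 + x 1 * w 1) * g x + cylRadius x ^ 2 * fderiv ℝ g x w := by
  have hθ : HasFDerivAt (fun y : EuclideanSpace ℝ (Fin 3) => cylRadius y ^ 2)
      ((2 * x 0) • (EuclideanSpace.proj (0 : Fin 3) : EuclideanSpace ℝ (Fin 3) →L[ℝ] ℝ) +
        (2 * x 1) • (EuclideanSpace.proj (1 : Fin 3) : EuclideanSpace ℝ (Fin 3) →L[ℝ] ℝ)) x :=
    hasFDerivAt_cylRadius_sq x
  rw [fderiv_fun_mul hθ.differentiableAt (hg x), hθ.fderiv]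
  simp only [_root_.add_apply, _root_.smul_apply, smul_eq_mul]
  have hp : ∀ i : Fin 3, (EuclideanSpace.proj i : EuclideanSpace ℝ (Fin 3) →L[ℝ] ℝ) w = w i :=
    fun i => rfl
  rw [hp 0, hp 1]
  ring

/-- **The weighted co-signed flux** (Gallay–Šverák 2015, Lemma 5.1 tested against the impulse
weight of Lemma 6.4; smooth class).  Let `(v, q)` be a Tao-class solution on `[0, T]` (`0 < ν`,
`0 < T`) from an axisymmetric swirl-free datum `u₀` with `η₀ = angVortQuot u₀ = ω_θ/r ∈ L¹`,
`Ω(t) = angVortQuot (v t)`; let `ψ` be continuous with `0 ≤ ψ ≤ |·|`, the pointwise limit of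
admissible convex `βₙ ≤ ψ` (so `ψ = (·)⁺`, `(·)⁻` are allowed).  Then for every `b ∈ (0, T]`:

`∫⁻ r² ψ(Ω(b,x)) dx ≤ ∫⁻ r² ψ(η₀(x)) dx + ofReal (∫_{t∈(0,b)} ∫ ψ(Ω(t,x)) · 2(x₀v₀ + x₁v₁)(t,x) dx dt)`

— the `r²`-moment of `ψ(η)` grows at most by the transport pairing `∫ ψ(η) D(r²)[u]`
(`D(r²)[u] = 2 r u_r`); the diffusion contributes nothing in the limit (no axis term for the
weight `r²`).  With `ψ = id` both signs this is the conservation of the impulse (Lemma 6.4);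
with `ψ = (·)^±` it bounds the impulse carried by each sign of `ω_θ` separately.
[cite: GallaySverak2016, §5 Lemma 5.1 and §6 Lemma 6.4 (arXiv pp. 16, 19)] -/
theorem IsTaoSolutionOn.lintegral_rsq_comp_angVortQuot_le (h : IsTaoSolutionOn T ν u₀ v q)
    (hT : 0 < T) (hν : 0 < ν) (h0 : IsAxisymmetric u₀) (h0' : HasNoSwirl u₀)
    (hL1 : Integrable (angVortQuot u₀))
    {ψ : ℝ → ℝ} {βs : ℕ → ℝ → ℝ} {Ks : ℕ → ℝ} (hψc : Continuous ψ) (hψ0 : ∀ w, 0 ≤ ψ w)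
    (hψle : ∀ w, ψ w ≤ |w|)
    (hβ : ∀ n, ContDiff ℝ 2 (βs n)) (h00 : ∀ n, βs n 0 = 0) (hd0 : ∀ n, deriv (βs n) 0 = 0)
    (hnn : ∀ n w, 0 ≤ deriv (deriv (βs n)) w) (hK : ∀ n w, deriv (deriv (βs n)) w ≤ Ks n)
    (hle : ∀ n w, βs n w ≤ ψ w) (hlim : ∀ w, Tendsto (fun n => βs n w) atTop (𝓝 (ψ w)))
    {b : ℝ} (hb : b ∈ Ioc 0 T) :
    ∫⁻ x, ENNReal.ofReal (cylRadius x ^ 2 * ψ (angVortQuot (v b) x)) ≤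
      (∫⁻ x, ENNReal.ofReal (cylRadius x ^ 2 * ψ (angVortQuot u₀ x))) +
      ENNReal.ofReal (∫ t in Ioo 0 b, ∫ x, ψ (angVortQuot (v t) x) *
        (2 * (x 0 * v t x 0 + x 1 * v t x 1))) := by
  have hU : UniqueDiffOn ℝ (Icc 0 T) := uniqueDiffOn_Icc hT
  have hsm : IsSmoothSpaceTimeOn (Icc 0 T) v := h.classical.smooth_velocity
  have hax : ∀ s ∈ Icc 0 T, IsAxisymmetric (v s) := h.isAxisymmetric hν hT h0
  have hsw : ∀ s ∈ Icc 0 T, HasNoSwirl (v s) := h.hasNoSwirl hν hT h0 h0'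
  have hbT : b ∈ Icc 0 T := ⟨hb.1.le, hb.2⟩
  have h0T : (0 : ℝ) ∈ Icc 0 T := ⟨le_rfl, hT.le⟩
  have hψabs : ∀ w, |ψ w| ≤ |w| := fun w => by rw [abs_of_nonneg (hψ0 w)]; exact hψle w
  have hΩc : ∀ t ∈ Icc 0 T, Continuous (angVortQuot (v t)) := fun t ht =>
    (contDiff_angVortQuot (n := 0) (by
      exact_mod_cast (h.classical.contDiff_velocity ht).of_le (by norm_cast))).continuous
  have hΩ : IsSmoothSpaceTimeOn (Icc 0 T) (fun t => angVortQuot (v t)) :=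
    hsm.angVortQuot_family (convex_Icc 0 T) hU
  obtain ⟨B, hB0, hB⟩ := h.exists_bound_velocity
  -- the sequence of weights `gₙ = g_{1/(n+1)}`
  set εs : ℕ → ℝ := fun n => 1 / ((n : ℝ) + 1) with hεs
  have hεpos : ∀ n, 0 < εs n := fun n => by rw [hεs]; positivity
  have hεlim : Tendsto εs atTop (𝓝 0) := tendsto_one_div_add_atTop_nhds_zero_nat
  set φs : ℕ → EuclideanSpace ℝ (Fin 3) → ℝ := fun n y => cylRadius y ^ 2 * impulseWeight (εs n) y
    with hφs
  set Fs : ℕ → ℝ → EuclideanSpace ℝ (Fin 3) → ℝ := fun n t x => fderiv ℝ (φs n) x (v t x) +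
    ν * VectorCalculus.divergence (fun y => (cylRadius y ^ 2) • gradient (impulseWeight (εs n)) y) x
    with hFs
  -- Step 1: the fixed-weight inequality for each `n`
  have hstep : ∀ n, ∫⁻ x, ENNReal.ofReal (φs n x * ψ (angVortQuot (v b) x)) ≤
      ENNReal.ofReal ((∫ x, φs n x * ψ (angVortQuot (v 0) x)) +
        ∫ t in Ioo 0 b, ∫ x, ψ (angVortQuot (v t) x) * Fs n t x) := by
    intro n
    have := h.lintegral_rsq_impulseWeight_comp_angVortQuot_le hT hν h0 h0' hL1 hψc hψ0 hψle hβ h00 hd0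
      hnn hK hle hlim (hεpos n) hb
    simpa only [hφs, hFs] using this
  -- Step 2: Fatou on the left
  have hg1 : ∀ n, ContDiff ℝ 1 (impulseWeight (εs n)) := fun n => contDiff_impulseWeight (hεpos n).le
  have hφc : ∀ n, Continuous (φs n) := fun n => (continuous_cylRadius.pow 2).mul (hg1 n).continuous
  have hφnn : ∀ n x, 0 ≤ φs n x := fun n x =>
    mul_nonneg (sq_nonneg _) (impulseWeight_pos (hεpos n).le x).le
  have hφle : ∀ n x, φs n x ≤ cylRadius x ^ 2 := fun n x => rsq_mul_impulseWeight_le (hεpos n).le x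
  have hφlim : ∀ x, Tendsto (fun n => φs n x) atTop (𝓝 (cylRadius x ^ 2)) := by
    intro x
    have h1 : Tendsto (fun n => impulseWeight (εs n) x) atTop (𝓝 1) :=
      (tendsto_impulseWeight_nhds_zero x).comp hεlim
    simpa using h1.const_mul (cylRadius x ^ 2)
  have hmeas : ∀ n, Measurable fun x => ENNReal.ofReal (φs n x * ψ (angVortQuot (v b) x)) := fun n =>
    ((hφc n).mul (hψc.comp (hΩc b hbT))).measurable.ennreal_ofReal
  have hFatou : ∫⁻ x, ENNReal.ofReal (cylRadius x ^ 2 * ψ (angVortQuot (v b) x)) ≤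
      liminf (fun n => ∫⁻ x, ENNReal.ofReal (φs n x * ψ (angVortQuot (v b) x))) atTop := by
    have hl : ∀ x, Tendsto (fun n => ENNReal.ofReal (φs n x * ψ (angVortQuot (v b) x))) atTop
        (𝓝 (ENNReal.ofReal (cylRadius x ^ 2 * ψ (angVortQuot (v b) x)))) := fun x =>
      (ENNReal.continuous_ofReal.tendsto _).comp ((hφlim x).mul_const _)
    calc ∫⁻ x, ENNReal.ofReal (cylRadius x ^ 2 * ψ (angVortQuot (v b) x))
        = ∫⁻ x, liminf (fun n => ENNReal.ofReal (φs n x * ψ (angVortQuot (v b) x))) atTop :=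
          lintegral_congr fun x => ((hl x).liminf_eq).symm
      _ ≤ _ := lintegral_liminf_le hmeas
  -- Step 3: the initial term is bounded by `∫⁻ r² ψ(η₀)`
  obtain ⟨hΩ0i, -⟩ := h.integrable_angVortQuot_of_datum hT hν h0 h0' hL1 h0T
  have hAint : ∀ n, Integrable (fun x => φs n x * ψ (angVortQuot (v 0) x)) := by
    intro n
    have h1 : Integrable (fun x => ψ (angVortQuot (v 0) x)) :=
      hΩ0i.norm.mono' ((hψc.comp (hΩc 0 h0T)).aestronglyMeasurable)
        (ae_of_all _ fun x => by rw [Real.norm_eq_abs, Real.norm_eq_abs]; exact hψabs _)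
    exact h1.bdd_mul (hφc n).aestronglyMeasurable (ae_of_all _ fun x => by
      rw [Real.norm_eq_abs]; exact abs_rsq_mul_impulseWeight_le_inv (hεpos n) x)
  have hA : ∀ n, ENNReal.ofReal (∫ x, φs n x * ψ (angVortQuot (v 0) x)) ≤
      ∫⁻ x, ENNReal.ofReal (cylRadius x ^ 2 * ψ (angVortQuot u₀ x)) := by
    intro n
    rw [ofReal_integral_eq_lintegral_ofReal (hAint n) (ae_of_all _ fun x =>
      mul_nonneg (hφnn n x) (hψ0 _)), h.initial]
    exact lintegral_mono fun x => ENNReal.ofReal_le_ofReal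
      (mul_le_mul_of_nonneg_right (hφle n x) (hψ0 _))
  -- Step 4: dominated convergence of the space-time term
  set μb : Measure (ℝ × EuclideanSpace ℝ (Fin 3)) := (volume.restrict (Ioo 0 b)).prod volume with hμb
  have hsub : Ioo 0 b ×ˢ {x : EuclideanSpace ℝ (Fin 3) | cylRadius x ≠ 0} ⊆ Icc 0 T ×ˢ univ :=
    prod_mono (fun t ht => ⟨ht.1.le, ht.2.le.trans hb.2⟩) (subset_univ _)
  have hS : ∀ᵐ z ∂μb, z.1 ∈ Ioo 0 b := by
    rw [ae_iff]
    have e : {z : ℝ × EuclideanSpace ℝ (Fin 3) | ¬ z.1 ∈ Ioo 0 b} = (Ioo 0 b)ᶜ ×ˢ univ := by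
      ext z; simp [mem_prod]
    rw [e, hμb, Measure.prod_prod, Measure.restrict_apply (measurableSet_Ioo.compl),
      compl_inter_self, measure_empty, zero_mul]
  -- continuity of the integrands
  have hr2 : ContDiff ℝ 1 fun y : EuclideanSpace ℝ (Fin 3) => cylRadius y ^ 2 := by
    have : (fun y : EuclideanSpace ℝ (Fin 3) => cylRadius y ^ 2) = fun y => y 0 ^ 2 + y 1 ^ 2 :=
      funext cylRadius_sq
    rw [this]; fun_prop
  have hφ1 : ∀ n, ContDiff ℝ 1 (φs n) := fun n => hr2.mul (hg1 n)
  have hFc : ∀ n, ContinuousOn (uncurry (Fs n)) (Icc 0 T ×ˢ univ) := by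
    intro n
    have c2 : ContinuousOn (fun p : ℝ × EuclideanSpace ℝ (Fin 3) => fderiv ℝ (φs n) p.2 (v p.1 p.2))
        (Icc 0 T ×ˢ univ) :=
      (((hφ1 n).continuous_fderiv one_ne_zero).comp_continuousOn continuous_snd.continuousOn).clm_apply
        hsm.continuousOn
    have c3 : ContinuousOn (fun p : ℝ × EuclideanSpace ℝ (Fin 3) => ν * VectorCalculus.divergence
        (fun y => (cylRadius y ^ 2) • gradient (impulseWeight (εs n)) y) p.2) (Icc 0 T ×ˢ univ) :=
      (continuous_const.mul ((continuous_divergence_rsq_gradient_impulseWeight (hεpos n).le).comp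
        continuous_snd)).continuousOn
    exact c2.add c3
  have hHc : ContinuousOn (uncurry fun t (x : EuclideanSpace ℝ (Fin 3)) => 2 * (x 0 * v t x 0 + x 1 * v t x 1))
      (Icc 0 T ×ˢ univ) := by
    have cv : ∀ i : Fin 3, ContinuousOn (fun p : ℝ × EuclideanSpace ℝ (Fin 3) => v p.1 p.2 i)
        (Icc 0 T ×ˢ univ) := fun i =>
      (PiLp.continuous_apply 2 _ i).comp_continuousOn hsm.continuousOn
    have cx : ∀ i : Fin 3, Continuous (fun p : ℝ × EuclideanSpace ℝ (Fin 3) => p.2 i) := fun i =>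
      (PiLp.continuous_apply 2 _ i).comp continuous_snd
    exact continuousOn_const.mul (((cx 0).continuousOn.mul (cv 0)).add ((cx 1).continuousOn.mul (cv 1)))
  have hGn_meas : ∀ n, AEStronglyMeasurable (uncurry fun t x => ψ (angVortQuot (v t) x) * Fs n t x) μb := by
    intro n
    refine aestronglyMeasurable_prod_of_continuousOn_off_axis ?_
    exact ((hψc.comp_continuousOn hΩ.continuousOn).mul (hFc n)).mono hsub
  have hG_meas : AEStronglyMeasurable (uncurry fun t (x : EuclideanSpace ℝ (Fin 3)) =>
      ψ (angVortQuot (v t) x) * (2 * (x 0 * v t x 0 + x 1 * v t x 1))) μb := by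
    refine aestronglyMeasurable_prod_of_continuousOn_off_axis ?_
    exact ((hψc.comp_continuousOn hΩ.continuousOn).mul hHc).mono hsub
  -- the dominating function `3((rΩ)² + ‖v‖²) + 20ν|Ω|`
  set D : ℝ × EuclideanSpace ℝ (Fin 3) → ℝ := fun z =>
    3 * ((cylRadius z.2 * angVortQuot (v z.1) z.2) ^ 2 + ‖v z.1 z.2‖ ^ 2) +
      20 * ν * |angVortQuot (v z.1) z.2| with hDdef
  have hDint : Integrable D μb := by
    -- measurability
    have hDm : AEStronglyMeasurable D μb := by
      refine aestronglyMeasurable_prod_of_continuousOn_off_axis ?_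
      have c1 : ContinuousOn (fun z : ℝ × EuclideanSpace ℝ (Fin 3) =>
          cylRadius z.2 * angVortQuot (v z.1) z.2) (Icc 0 T ×ˢ univ) :=
        (continuous_cylRadius.comp_continuousOn continuous_snd.continuousOn).mul hΩ.continuousOn
      have c2 : ContinuousOn (fun z : ℝ × EuclideanSpace ℝ (Fin 3) => ‖v z.1 z.2‖) (Icc 0 T ×ˢ univ) :=
        hsm.continuousOn.norm
      have c3 : ContinuousOn (fun z : ℝ × EuclideanSpace ℝ (Fin 3) => |angVortQuot (v z.1) z.2|)
          (Icc 0 T ×ˢ univ) := continuous_abs.comp_continuousOn hΩ.continuousOn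
      exact ((continuousOn_const.mul ((c1.pow 2).add (c2.pow 2))).add (continuousOn_const.mul c3)).mono
        hsub
    refine ⟨hDm, ?_⟩
    -- uniform slice bound
    obtain ⟨C₁, hC₁⟩ := h.sobolev 1
    have hslice : ∀ t ∈ Ioo 0 b, ∫⁻ x, ‖D (t, x)‖ₑ ≤
        ENNReal.ofReal 3 * (ENNReal.ofReal (‖curlCLM‖ ^ 2) * C₁ +
          ENNReal.ofReal (2 * VectorCalculus.kineticEnergy u₀)) +
        ENNReal.ofReal (20 * ν) * ∫⁻ x, ‖angVortQuot u₀ x‖ₑ := by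
      intro t ht
      have htI : t ∈ Icc 0 T := ⟨ht.1.le, ht.2.le.trans hb.2⟩
      have hv3 : ContDiff ℝ 3 (v t) := (h.classical.contDiff_velocity htI).of_le (by norm_cast)
      have hωeq : ∀ x, ‖curl (v t) x‖ = cylRadius x * |angVortQuot (v t) x| :=
        norm_curl_eq_cylRadius_mul_abs_angVortQuot (hax t htI) (hsw t htI) hv3
      -- pointwise: `‖D‖ₑ = 3((rΩ)² + ‖v‖²) + 20ν|Ω|` as a sum of `ℝ≥0∞` terms
      have hpt : ∀ x, ‖D (t, x)‖ₑ = ENNReal.ofReal 3 * (‖curl (v t) x‖ₑ ^ 2 + ‖v t x‖ₑ ^ 2) +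
          ENNReal.ofReal (20 * ν) * ‖angVortQuot (v t) x‖ₑ := by
        intro x
        have hnn : 0 ≤ D (t, x) := by
          simp only [hDdef]
          positivity
        rw [Real.enorm_eq_ofReal hnn, hDdef]
        simp only
        rw [ENNReal.ofReal_add (by positivity) (by positivity), ENNReal.ofReal_mul (by norm_num),
          ENNReal.ofReal_add (by positivity) (by positivity), ENNReal.ofReal_mul (by positivity),
          ← Real.enorm_eq_ofReal_abs, ← sq_abs, abs_mul, abs_of_nonneg (cylRadius_nonneg x), ← hωeq x,
          ENNReal.ofReal_pow (norm_nonneg _), ofReal_norm, ENNReal.ofReal_pow (norm_nonneg _), ofReal_norm]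
      have hm1 : Measurable fun x => ‖curl (v t) x‖ₑ ^ 2 :=
        (continuous_curl ((h.classical.contDiff_velocity htI).of_le (by norm_cast))).measurable.enorm.pow_const 2
      have hm2 : Measurable fun x => ‖v t x‖ₑ ^ 2 :=
        (h.classical.contDiff_velocity htI).continuous.measurable.enorm.pow_const 2
      have hm12' : Measurable fun x => ‖curl (v t) x‖ₑ ^ 2 + ‖v t x‖ₑ ^ 2 := hm1.add hm2
      have hm12 : Measurable fun x => ENNReal.ofReal 3 * (‖curl (v t) x‖ₑ ^ 2 + ‖v t x‖ₑ ^ 2) :=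
        hm12'.const_mul _
      have hm3 : Measurable fun x => ‖angVortQuot (v t) x‖ₑ := (hΩc t htI).measurable.enorm
      rw [lintegral_congr hpt, lintegral_add_left hm12, lintegral_const_mul _ hm12',
        lintegral_add_left hm1, lintegral_const_mul _ hm3]
      -- enstrophy bound
      have hcurl : ∫⁻ x, ‖curl (v t) x‖ₑ ^ 2 ≤ ENNReal.ofReal (‖curlCLM‖ ^ 2) * C₁ := by
        calc ∫⁻ x, ‖curl (v t) x‖ₑ ^ 2 ≤ ∫⁻ x, ENNReal.ofReal (‖curlCLM‖ ^ 2) *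
              ‖iteratedFDeriv ℝ 1 (v t) x‖ₑ ^ 2 := by
              refine lintegral_mono fun x => ?_
              rw [← ofReal_norm, ← ofReal_norm, ← ENNReal.ofReal_pow (norm_nonneg _),
                ← ENNReal.ofReal_pow (norm_nonneg _), ← ENNReal.ofReal_mul (sq_nonneg _),
                norm_iteratedFDeriv_one, ← mul_pow]
              exact ENNReal.ofReal_le_ofReal (pow_le_pow_left₀ (norm_nonneg _)
                (FluidPDE.norm_curl_le (v t) x) 2)
          _ = ENNReal.ofReal (‖curlCLM‖ ^ 2) * ∫⁻ x, ‖iteratedFDeriv ℝ 1 (v t) x‖ₑ ^ 2 := by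
              rw [lintegral_const_mul']
              exact ENNReal.ofReal_ne_top
          _ ≤ ENNReal.ofReal (‖curlCLM‖ ^ 2) * C₁ := by gcongr; exact hC₁ t htI
      have hen : ∫⁻ x, ‖v t x‖ₑ ^ 2 ≤ ENNReal.ofReal (2 * VectorCalculus.kineticEnergy u₀) :=
        h.lintegral_enorm_sq_le hT hν.le htI
      have hL1t := (h.integrable_angVortQuot_of_datum hT hν h0 h0' hL1 htI).2
      gcongr
    have hle := lintegral_prod_le (μ := volume.restrict (Ioo 0 b))
      (ν := (volume : Measure (EuclideanSpace ℝ (Fin 3)))) (fun z : ℝ × EuclideanSpace ℝ (Fin 3) => ‖D z‖ₑ)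
    refine lt_of_le_of_lt hle ?_
    calc ∫⁻ t in Ioo 0 b, ∫⁻ x, ‖D (t, x)‖ₑ ≤ ∫⁻ _ in Ioo 0 b,
          (ENNReal.ofReal 3 * (ENNReal.ofReal (‖curlCLM‖ ^ 2) * C₁ +
            ENNReal.ofReal (2 * VectorCalculus.kineticEnergy u₀)) +
          ENNReal.ofReal (20 * ν) * ∫⁻ x, ‖angVortQuot u₀ x‖ₑ) :=
          setLIntegral_mono' measurableSet_Ioo fun t ht => hslice t ht
      _ < ⊤ := by
          rw [setLIntegral_const]
          refine ENNReal.mul_lt_top ?_ (by simp)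
          refine ENNReal.add_lt_top.2 ⟨ENNReal.mul_lt_top ENNReal.ofReal_lt_top
            (ENNReal.add_lt_top.2 ⟨ENNReal.mul_lt_top ENNReal.ofReal_lt_top ENNReal.coe_lt_top,
              ENNReal.ofReal_lt_top⟩), ENNReal.mul_lt_top ENNReal.ofReal_lt_top hL1.hasFiniteIntegral⟩
  -- pointwise bound `|ψ(Ω) Fₙ| ≤ D` for `t ∈ (0, b)`
  have hGn_bound : ∀ n, ∀ᵐ z ∂μb, ‖uncurry (fun t x => ψ (angVortQuot (v t) x) * Fs n t x) z‖ ≤ D z := by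
    intro n
    filter_upwards [hS] with z hz
    obtain ⟨t, x⟩ := z
    have htI : t ∈ Icc 0 T := ⟨hz.1.le, hz.2.le.trans hb.2⟩
    have hgd : Differentiable ℝ (impulseWeight (εs n)) := (hg1 n).differentiable one_ne_zero
    simp only [uncurry_apply_pair, Real.norm_eq_abs, hDdef]
    -- `|Fₙ| ≤ 6 r ‖v‖ + 20 ν`
    have hF : |Fs n t x| ≤ 6 * cylRadius x * ‖v t x‖ + 20 * ν := by
      simp only [hFs, hφs]
      rw [fderiv_cylRadius_sq_mul_apply₃ hgd]
      have t1 : |2 * (x 0 * v t x 0 + x 1 * v t x 1) * impulseWeight (εs n) x| ≤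
          2 * (cylRadius x * ‖v t x‖) := by
        rw [abs_mul, abs_mul, abs_two, abs_of_nonneg (impulseWeight_pos (hεpos n).le x).le]
        calc 2 * |x 0 * v t x 0 + x 1 * v t x 1| * impulseWeight (εs n) x
            ≤ 2 * (cylRadius x * ‖v t x‖) * 1 :=
              mul_le_mul (mul_le_mul_of_nonneg_left (abs_horizontal_inner_le_rad x (v t x)) zero_le_two)
                (impulseWeight_le_one (hεpos n).le x) (impulseWeight_pos (hεpos n).le x).le
                (mul_nonneg zero_le_two (mul_nonneg (cylRadius_nonneg x) (norm_nonneg _)))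
          _ = 2 * (cylRadius x * ‖v t x‖) := mul_one _
      have t2 := abs_rsq_mul_fderiv_impulseWeight_le (hεpos n).le x (v t x)
      have t3 : |ν * VectorCalculus.divergence
          (fun y => (cylRadius y ^ 2) • gradient (impulseWeight (εs n)) y) x| ≤ ν * 20 := by
        rw [abs_mul, abs_of_pos hν]
        exact mul_le_mul_of_nonneg_left (abs_divergence_rsq_gradient_impulseWeight_le (hεpos n).le x) hν.le
      calc _ ≤ |2 * (x 0 * v t x 0 + x 1 * v t x 1) * impulseWeight (εs n) x| +
            |cylRadius x ^ 2 * fderiv ℝ (impulseWeight (εs n)) x (v t x)| +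
            |ν * VectorCalculus.divergence
              (fun y => (cylRadius y ^ 2) • gradient (impulseWeight (εs n)) y) x| :=
            (abs_add_le _ _).trans (add_le_add (abs_add_le _ _) le_rfl)
        _ ≤ 2 * (cylRadius x * ‖v t x‖) + 4 * cylRadius x * ‖v t x‖ + ν * 20 :=
            add_le_add (add_le_add t1 t2) t3
        _ = 6 * cylRadius x * ‖v t x‖ + 20 * ν := by ring
    rw [abs_mul]
    have hΩa := abs_nonneg (angVortQuot (v t) x)
    have hr := cylRadius_nonneg x
    calc |ψ (angVortQuot (v t) x)| * |Fs n t x|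
        ≤ |angVortQuot (v t) x| * (6 * cylRadius x * ‖v t x‖ + 20 * ν) :=
          mul_le_mul (hψabs _) hF (abs_nonneg _) hΩa
      _ = 2 * (3 * (cylRadius x * |angVortQuot (v t) x|) * ‖v t x‖) + 20 * ν * |angVortQuot (v t) x| := by
          ring
      _ ≤ 3 * ((cylRadius x * angVortQuot (v t) x) ^ 2 + ‖v t x‖ ^ 2) +
          20 * ν * |angVortQuot (v t) x| := by
          have : 2 * ((cylRadius x * |angVortQuot (v t) x|) * ‖v t x‖) ≤
              (cylRadius x * |angVortQuot (v t) x|) ^ 2 + ‖v t x‖ ^ 2 := by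
            have h2 := two_mul_le_add_sq (cylRadius x * |angVortQuot (v t) x|) ‖v t x‖
            linarith
          have e : (cylRadius x * |angVortQuot (v t) x|) ^ 2 = (cylRadius x * angVortQuot (v t) x) ^ 2 := by
            rw [mul_pow, mul_pow, sq_abs]
          nlinarith [this, e]
  -- pointwise limit `ψ(Ω) Fₙ → ψ(Ω) · 2(x₀v₀ + x₁v₁)`
  have hG_lim : ∀ᵐ z ∂μb, Tendsto (fun n => uncurry (fun t x => ψ (angVortQuot (v t) x) * Fs n t x) z)
      atTop (𝓝 (uncurry (fun t (x : EuclideanSpace ℝ (Fin 3)) =>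
        ψ (angVortQuot (v t) x) * (2 * (x 0 * v t x 0 + x 1 * v t x 1))) z)) := by
    refine ae_of_all _ fun z => ?_
    obtain ⟨t, x⟩ := z
    simp only [uncurry_apply_pair]
    refine Tendsto.const_mul _ ?_
    -- the three pieces of `Fₙ t x`
    have e : ∀ n, Fs n t x = 2 * (x 0 * v t x 0 + x 1 * v t x 1) * impulseWeight (εs n) x +
        cylRadius x ^ 2 * fderiv ℝ (impulseWeight (εs n)) x (v t x) +
        ν * VectorCalculus.divergence
          (fun y => (cylRadius y ^ 2) • gradient (impulseWeight (εs n)) y) x := by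
      intro n
      simp only [hFs, hφs]
      rw [fderiv_cylRadius_sq_mul_apply₃ ((hg1 n).differentiable one_ne_zero)]
    simp_rw [e]
    have l1 : Tendsto (fun n => 2 * (x 0 * v t x 0 + x 1 * v t x 1) * impulseWeight (εs n) x) atTop
        (𝓝 (2 * (x 0 * v t x 0 + x 1 * v t x 1) * 1)) :=
      ((tendsto_impulseWeight_nhds_zero x).comp hεlim).const_mul _
    have l2 : Tendsto (fun n => cylRadius x ^ 2 * fderiv ℝ (impulseWeight (εs n)) x (v t x)) atTop
        (𝓝 0) := by
      have hbd : ∀ n, |cylRadius x ^ 2 * fderiv ℝ (impulseWeight (εs n)) x (v t x)| ≤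
          4 * εs n * cylRadius x ^ 2 * ‖x‖ * ‖v t x‖ := fun n =>
        abs_rsq_mul_fderiv_impulseWeight_le_eps (hεpos n).le x (v t x)
      have hz : Tendsto (fun n => 4 * εs n * cylRadius x ^ 2 * ‖x‖ * ‖v t x‖) atTop (𝓝 0) := by
        have := ((hεlim.const_mul 4).mul_const (cylRadius x ^ 2)).mul_const ‖x‖ |>.mul_const ‖v t x‖
        simpa using this
      exact squeeze_zero_norm (fun n => by rw [Real.norm_eq_abs]; exact hbd n) hz
    have l3 : Tendsto (fun n => ν * VectorCalculus.divergence
        (fun y => (cylRadius y ^ 2) • gradient (impulseWeight (εs n)) y) x) atTop (𝓝 0) := by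
      have hbd : ∀ n, |ν * VectorCalculus.divergence
          (fun y => (cylRadius y ^ 2) • gradient (impulseWeight (εs n)) y) x| ≤
          |ν| * (20 * εs n * ‖x‖ ^ 2) := fun n => by
        rw [abs_mul]
        exact mul_le_mul_of_nonneg_left
          (abs_divergence_rsq_gradient_impulseWeight_le_eps (hεpos n).le x) (abs_nonneg _)
      have hz : Tendsto (fun n => |ν| * (20 * εs n * ‖x‖ ^ 2)) atTop (𝓝 0) := by
        have := ((hεlim.const_mul 20).mul_const (‖x‖ ^ 2)).const_mul |ν|
        simpa using this
      exact squeeze_zero_norm (fun n => by rw [Real.norm_eq_abs]; exact hbd n) hz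
    have := (l1.add l2).add l3
    simpa using this
  have hItend := tendsto_integral_of_dominated_convergence D hGn_meas hDint hGn_bound hG_lim
  -- Fubini on both sides
  have hG_bound : ∀ᵐ z ∂μb, ‖uncurry (fun t (x : EuclideanSpace ℝ (Fin 3)) =>
      ψ (angVortQuot (v t) x) * (2 * (x 0 * v t x 0 + x 1 * v t x 1))) z‖ ≤ D z := by
    filter_upwards [hS] with z hz
    obtain ⟨t, x⟩ := z
    simp only [uncurry_apply_pair, Real.norm_eq_abs, hDdef, abs_mul, abs_two]
    have hΩa := abs_nonneg (angVortQuot (v t) x)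
    calc |ψ (angVortQuot (v t) x)| * (2 * |x 0 * v t x 0 + x 1 * v t x 1|)
        ≤ |angVortQuot (v t) x| * (2 * (cylRadius x * ‖v t x‖)) :=
          mul_le_mul (hψabs _) (mul_le_mul_of_nonneg_left (abs_horizontal_inner_le_rad x (v t x)) zero_le_two)
            (by positivity) hΩa
      _ = 2 * (cylRadius x * |angVortQuot (v t) x|) * ‖v t x‖ := by ring
      _ ≤ (cylRadius x * |angVortQuot (v t) x|) ^ 2 + ‖v t x‖ ^ 2 := two_mul_le_add_sq _ _
      _ = (cylRadius x * angVortQuot (v t) x) ^ 2 + ‖v t x‖ ^ 2 := by rw [mul_pow, mul_pow, sq_abs]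
      _ ≤ 3 * ((cylRadius x * angVortQuot (v t) x) ^ 2 + ‖v t x‖ ^ 2) + 20 * ν * |angVortQuot (v t) x| := by
          nlinarith [sq_nonneg (cylRadius x * angVortQuot (v t) x), sq_nonneg ‖v t x‖,
            mul_nonneg (mul_nonneg (by norm_num : (0:ℝ) ≤ 20) hν.le) hΩa]
  have hGn_int : ∀ n, Integrable (uncurry fun t x => ψ (angVortQuot (v t) x) * Fs n t x) μb :=
    fun n => hDint.mono' (hGn_meas n) (hGn_bound n)
  have hG_int : Integrable (uncurry fun t (x : EuclideanSpace ℝ (Fin 3)) =>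
      ψ (angVortQuot (v t) x) * (2 * (x 0 * v t x 0 + x 1 * v t x 1))) μb :=
    hDint.mono' hG_meas hG_bound
  have hIn_eq : ∀ n, ∫ z, uncurry (fun t x => ψ (angVortQuot (v t) x) * Fs n t x) z ∂μb =
      ∫ t in Ioo 0 b, ∫ x, ψ (angVortQuot (v t) x) * Fs n t x := fun n => by
    rw [hμb, integral_prod _ (hGn_int n)]
    rfl
  have hI_eq : ∫ z, uncurry (fun t (x : EuclideanSpace ℝ (Fin 3)) =>
      ψ (angVortQuot (v t) x) * (2 * (x 0 * v t x 0 + x 1 * v t x 1))) z ∂μb =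
      ∫ t in Ioo 0 b, ∫ x, ψ (angVortQuot (v t) x) * (2 * (x 0 * v t x 0 + x 1 * v t x 1)) := by
    rw [hμb, integral_prod _ hG_int]
    rfl
  have hI : Tendsto (fun n => ∫ t in Ioo 0 b, ∫ x, ψ (angVortQuot (v t) x) * Fs n t x) atTop
      (𝓝 (∫ t in Ioo 0 b, ∫ x, ψ (angVortQuot (v t) x) * (2 * (x 0 * v t x 0 + x 1 * v t x 1)))) := by
    rw [← hI_eq]
    simp_rw [← hIn_eq]
    exact hItend
  -- combine: each term is `≤ X₀ + ofReal(Iₙ)`, and `ofReal(Iₙ) → ofReal(I)`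
  set X₀ : ℝ≥0∞ := ∫⁻ x, ENNReal.ofReal (cylRadius x ^ 2 * ψ (angVortQuot u₀ x)) with hX₀
  have hstep' : ∀ n, ∫⁻ x, ENNReal.ofReal (φs n x * ψ (angVortQuot (v b) x)) ≤
      X₀ + ENNReal.ofReal (∫ t in Ioo 0 b, ∫ x, ψ (angVortQuot (v t) x) * Fs n t x) := fun n =>
    (hstep n).trans (ENNReal.ofReal_add_le.trans (add_le_add (hA n) le_rfl))
  have hlim2 : Tendsto (fun n => X₀ + ENNReal.ofReal (∫ t in Ioo 0 b, ∫ x,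
      ψ (angVortQuot (v t) x) * Fs n t x)) atTop (𝓝 (X₀ + ENNReal.ofReal (∫ t in Ioo 0 b, ∫ x,
        ψ (angVortQuot (v t) x) * (2 * (x 0 * v t x 0 + x 1 * v t x 1))))) :=
    ((ENNReal.continuous_ofReal.tendsto _).comp hI).const_add X₀
  calc ∫⁻ x, ENNReal.ofReal (cylRadius x ^ 2 * ψ (angVortQuot (v b) x))
      ≤ liminf (fun n => ∫⁻ x, ENNReal.ofReal (φs n x * ψ (angVortQuot (v b) x))) atTop := hFatou
    _ ≤ liminf (fun n => X₀ + ENNReal.ofReal (∫ t in Ioo 0 b, ∫ x,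
          ψ (angVortQuot (v t) x) * Fs n t x)) atTop := liminf_le_liminf (Eventually.of_forall hstep')
    _ = X₀ + ENNReal.ofReal (∫ t in Ioo 0 b, ∫ x,
          ψ (angVortQuot (v t) x) * (2 * (x 0 * v t x 0 + x 1 * v t x 1))) := hlim2.liminf_eq

end Limit

/-! ### Smooth convex approximants of `(·)⁺` and `(·)⁻` (private copies) and the two flux bounds -/

section Approx

variable {δ : ℝ}

/-- The integrand `r ↦ smoothTransition (r/δ)` is smooth. [folklore] -/
private theorem contDiff_smoothTransition_div' (δ : ℝ) {n : ℕ∞} :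
    ContDiff ℝ n fun r : ℝ => Real.smoothTransition (r / δ) :=
  Real.smoothTransition.contDiff.comp (contDiff_id.div_const δ)

/-- `β_δ' (w) = smoothTransition (w/δ)`. [folklore] -/
private theorem hasDerivAt_posApprox' (δ w : ℝ) :
    HasDerivAt (fun w => ∫ r in (0 : ℝ)..w, Real.smoothTransition (r / δ))
      (Real.smoothTransition (w / δ)) w := by
  have hc : Continuous fun r : ℝ => Real.smoothTransition (r / δ) :=
    (contDiff_smoothTransition_div' δ (n := 0)).continuous
  exact intervalIntegral.integral_hasDerivAt_right (hc.intervalIntegrable _ _)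
    (hc.stronglyMeasurableAtFilter _ _) hc.continuousAt

/-- `deriv β_δ = smoothTransition (·/δ)`. [folklore] -/
private theorem deriv_posApprox' (δ : ℝ) :
    deriv (fun w => ∫ r in (0 : ℝ)..w, Real.smoothTransition (r / δ)) =
      fun w => Real.smoothTransition (w / δ) :=
  funext fun w => (hasDerivAt_posApprox' δ w).deriv

/-- `β_δ ∈ C²`. [folklore] -/
private theorem contDiff_posApprox' (δ : ℝ) :
    ContDiff ℝ 2 fun w => ∫ r in (0 : ℝ)..w, Real.smoothTransition (r / δ) := by
  rw [show (2 : WithTop ℕ∞) = 1 + 1 by norm_num, contDiff_succ_iff_deriv]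
  refine ⟨fun w => (hasDerivAt_posApprox' δ w).differentiableAt, fun h => absurd h (by simp), ?_⟩
  rw [deriv_posApprox']
  exact_mod_cast contDiff_smoothTransition_div' δ (n := 1)

/-- `β_δ''(w) = smoothTransition' (w/δ) / δ`. [folklore] -/
private theorem deriv_deriv_posApprox' (δ w : ℝ) :
    deriv (deriv fun w => ∫ r in (0 : ℝ)..w, Real.smoothTransition (r / δ)) w =
      deriv Real.smoothTransition (w / δ) / δ := by
  rw [deriv_posApprox']
  have h1 : HasDerivAt Real.smoothTransition (deriv Real.smoothTransition (w / δ)) (w / δ) :=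
    (Calculus.differentiable_smoothTransition (w / δ)).hasDerivAt
  have h2 := h1.comp w ((hasDerivAt_id w).div_const δ)
  have h : HasDerivAt (fun w => Real.smoothTransition (w / δ))
      (deriv Real.smoothTransition (w / δ) * (1 / δ)) w := h2
  rw [h.deriv]
  ring

/-- `β_δ(w) = 0` for `w ≤ 0`. [folklore] -/
private theorem posApprox_of_nonpos' (hδ : 0 < δ) {w : ℝ} (hw : w ≤ 0) :
    (∫ r in (0 : ℝ)..w, Real.smoothTransition (r / δ)) = 0 := by
  rw [intervalIntegral.integral_symm]
  have : (∫ r in w..(0 : ℝ), Real.smoothTransition (r / δ)) = ∫ _ in w..(0 : ℝ), (0 : ℝ) := by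
    refine intervalIntegral.integral_congr fun r hr => ?_
    rw [uIcc_of_le hw] at hr
    exact Real.smoothTransition.zero_of_nonpos (div_nonpos_of_nonpos_of_nonneg hr.2 hδ.le)
  rw [this, intervalIntegral.integral_zero, neg_zero]

/-- `β_δ(w) ≤ w⁺`. [folklore] -/
private theorem posApprox_le_posPart' (hδ : 0 < δ) (w : ℝ) :
    (∫ r in (0 : ℝ)..w, Real.smoothTransition (r / δ)) ≤ w⁺ := by
  rcases le_or_gt w 0 with hw | hw
  · rw [posApprox_of_nonpos' hδ hw]; exact posPart_nonneg _
  · have h1 : (∫ r in (0 : ℝ)..w, Real.smoothTransition (r / δ)) ≤ ∫ _ in (0 : ℝ)..w, (1 : ℝ) :=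
      intervalIntegral.integral_mono_on hw.le
        ((contDiff_smoothTransition_div' δ (n := 0)).continuous.intervalIntegrable _ _)
        (continuous_const.intervalIntegrable _ _) fun r _ => Real.smoothTransition.le_one _
    rw [intervalIntegral.integral_const, smul_eq_mul, mul_one, sub_zero] at h1
    exact h1.trans (le_posPart w)

/-- `w⁺ − δ ≤ β_δ(w)`. [folklore] -/
private theorem posPart_sub_le_posApprox' (hδ : 0 < δ) (w : ℝ) :
    w⁺ - δ ≤ ∫ r in (0 : ℝ)..w, Real.smoothTransition (r / δ) := by
  have hc : Continuous fun r : ℝ => Real.smoothTransition (r / δ) :=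
    (contDiff_smoothTransition_div' δ (n := 0)).continuous
  rcases le_or_gt w 0 with hw | hw
  · rw [posApprox_of_nonpos' hδ hw, posPart_eq_zero.2 hw]; linarith
  rw [posPart_eq_self.2 hw.le]
  rcases le_or_gt w δ with hwδ | hwδ
  · have h0 : 0 ≤ ∫ r in (0 : ℝ)..w, Real.smoothTransition (r / δ) :=
      intervalIntegral.integral_nonneg hw.le fun r _ => Real.smoothTransition.nonneg _
    linarith
  · rw [← intervalIntegral.integral_add_adjacent_intervals (b := δ) (hc.intervalIntegrable _ _)
      (hc.intervalIntegrable _ _)]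
    have h0 : 0 ≤ ∫ r in (0 : ℝ)..δ, Real.smoothTransition (r / δ) :=
      intervalIntegral.integral_nonneg hδ.le fun r _ => Real.smoothTransition.nonneg _
    have h1 : (∫ r in δ..w, Real.smoothTransition (r / δ)) = ∫ _ in δ..w, (1 : ℝ) := by
      refine intervalIntegral.integral_congr fun r hr => ?_
      rw [uIcc_of_le hwδ.le] at hr
      exact Real.smoothTransition.one_of_one_le ((one_le_div hδ).2 hr.1)
    rw [h1, intervalIntegral.integral_const, smul_eq_mul, mul_one]
    linarith

/-- `β_{1/(n+1)}(w) → w⁺`. [folklore] -/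
private theorem tendsto_posApprox' (w : ℝ) :
    Tendsto (fun n : ℕ => ∫ r in (0 : ℝ)..w, Real.smoothTransition (r / ((1 : ℝ) / (n + 1)))) atTop
      (𝓝 (w⁺)) := by
  have h0 : Tendsto (fun n : ℕ => w⁺ - (1 : ℝ) / ((n : ℝ) + 1)) atTop (𝓝 (w⁺ - 0)) :=
    tendsto_const_nhds.sub tendsto_one_div_add_atTop_nhds_zero_nat
  rw [sub_zero] at h0
  refine tendsto_of_tendsto_of_tendsto_of_le_of_le h0 tendsto_const_nhds (fun n => ?_) fun n => ?_
  · exact posPart_sub_le_posApprox' (by positivity) w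
  · exact posApprox_le_posPart' (by positivity) w

/-- `deriv (w ↦ β_δ(−w)) = −smoothTransition (−·/δ)`. [folklore] -/
private theorem deriv_negApprox' (δ : ℝ) :
    deriv (fun w => ∫ r in (0 : ℝ)..(-w), Real.smoothTransition (r / δ)) =
      fun w => -Real.smoothTransition (-w / δ) := by
  funext w
  have h := (hasDerivAt_posApprox' δ (-w)).comp w (hasDerivAt_neg w)
  have e : Real.smoothTransition (-w / δ) * -1 = -Real.smoothTransition (-w / δ) := by ring
  rw [← e]
  exact h.deriv

/-- `(w ↦ β_δ(−w))'' (w) = smoothTransition' (−w/δ) / δ`. [folklore] -/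
private theorem deriv_deriv_negApprox' (δ w : ℝ) :
    deriv (deriv fun w => ∫ r in (0 : ℝ)..(-w), Real.smoothTransition (r / δ)) w =
      deriv Real.smoothTransition (-w / δ) / δ := by
  rw [deriv_negApprox']
  have h1 : HasDerivAt Real.smoothTransition (deriv Real.smoothTransition (-w / δ)) (-w / δ) :=
    (Calculus.differentiable_smoothTransition (-w / δ)).hasDerivAt
  have h2 := (h1.comp w ((hasDerivAt_neg w).div_const δ)).neg
  have h : HasDerivAt (fun w => -Real.smoothTransition (-w / δ))
      (-(deriv Real.smoothTransition (-w / δ) * (-1 / δ))) w := h2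
  rw [h.deriv]
  ring

/-- `w⁺ ≤ |w|`. [folklore] -/
private theorem posPart_le_abs' (w : ℝ) : w⁺ ≤ |w| :=
  calc w⁺ ≤ w⁺ + w⁻ := le_add_of_nonneg_right (negPart_nonneg w)
    _ = |w| := posPart_add_negPart w

/-- `w⁻ ≤ |w|`. [folklore] -/
private theorem negPart_le_abs' (w : ℝ) : w⁻ ≤ |w| :=
  calc w⁻ ≤ w⁺ + w⁻ := le_add_of_nonneg_left (posPart_nonneg w)
    _ = |w| := posPart_add_negPart w

/-- `r ↦ r⁺` is continuous on `ℝ`. [folklore] -/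
private theorem continuous_posPart_real' : Continuous fun r : ℝ => r⁺ := by
  have e : (fun r : ℝ => r⁺) = fun r => max r 0 := funext fun r => by rw [posPart_def]
  rw [e]
  exact continuous_id.max continuous_const

/-- `r ↦ r⁻` is continuous on `ℝ`. [folklore] -/
private theorem continuous_negPart_real' : Continuous fun r : ℝ => r⁻ := by
  have e : (fun r : ℝ => r⁻) = fun r => max (-r) 0 := funext fun r => by rw [negPart_def]
  rw [e]
  exact continuous_neg.max continuous_const

variable {T ν : ℝ} {u₀ : EuclideanSpace ℝ (Fin 3) → EuclideanSpace ℝ (Fin 3)}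
  {v : ℝ → EuclideanSpace ℝ (Fin 3) → EuclideanSpace ℝ (Fin 3)}
  {q : ℝ → EuclideanSpace ℝ (Fin 3) → ℝ}

/-- **Weighted co-signed flux, positive part** (Gallay–Šverák 2015, Lemma 5.1 × Lemma 6.4, smooth
class).  Along a Tao-class solution (`0 < ν`, `0 < T`) from an axisymmetric swirl-free datum with
`η₀ = ω_θ/r ∈ L¹`, for every `b ∈ (0, T]`:
`∫⁻ r² (Ω(b))⁺ ≤ ∫⁻ r² (η₀)⁺ + ofReal (∫_{t∈(0,b)}∫ (Ω(t))⁺ · 2(x₀v₀ + x₁v₁))` —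
the impulse carried by the positive azimuthal vorticity grows at most by its transport pairing.
[cite: GallaySverak2016, §5 Lemma 5.1 and §6 Lemma 6.4 (arXiv pp. 16, 19)] -/
theorem IsTaoSolutionOn.lintegral_rsq_posPart_angVortQuot_le (h : IsTaoSolutionOn T ν u₀ v q)
    (hT : 0 < T) (hν : 0 < ν) (h0 : IsAxisymmetric u₀) (h0' : HasNoSwirl u₀)
    (hL1 : Integrable (angVortQuot u₀)) {b : ℝ} (hb : b ∈ Ioc 0 T) :
    ∫⁻ x, ENNReal.ofReal (cylRadius x ^ 2 * (angVortQuot (v b) x)⁺) ≤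
      (∫⁻ x, ENNReal.ofReal (cylRadius x ^ 2 * (angVortQuot u₀ x)⁺)) +
      ENNReal.ofReal (∫ t in Ioo 0 b, ∫ x, (angVortQuot (v t) x)⁺ *
        (2 * (x 0 * v t x 0 + x 1 * v t x 1))) := by
  obtain ⟨D, -, hD⟩ := Calculus.exists_bound_deriv_smoothTransition
  exact h.lintegral_rsq_comp_angVortQuot_le hT hν h0 h0' hL1
    (βs := fun n w => ∫ r in (0 : ℝ)..w, Real.smoothTransition (r / ((1 : ℝ) / (n + 1))))
    (Ks := fun n => D / ((1 : ℝ) / (n + 1))) continuous_posPart_real' (fun w => posPart_nonneg w)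
    (fun w => posPart_le_abs' w)
    (fun n => contDiff_posApprox' _) (fun n => intervalIntegral.integral_same)
    (fun n => by rw [deriv_posApprox']; simp [Real.smoothTransition.zero_of_nonpos])
    (fun n w => by
      rw [deriv_deriv_posApprox']
      exact div_nonneg Real.smoothTransition.monotone.deriv_nonneg (by positivity))
    (fun n w => by
      rw [deriv_deriv_posApprox']
      exact div_le_div_of_nonneg_right ((le_abs_self _).trans (hD _)) (by positivity))
    (fun n w => posApprox_le_posPart' (by positivity) w) tendsto_posApprox' hb

/-- **Weighted co-signed flux, negative part**: under the same hypotheses,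
`∫⁻ r² (Ω(b))⁻ ≤ ∫⁻ r² (η₀)⁻ + ofReal (∫_{t∈(0,b)}∫ (Ω(t))⁻ · 2(x₀v₀ + x₁v₁))`.
[cite: GallaySverak2016, §5 Lemma 5.1 and §6 Lemma 6.4 (arXiv pp. 16, 19)] -/
theorem IsTaoSolutionOn.lintegral_rsq_negPart_angVortQuot_le (h : IsTaoSolutionOn T ν u₀ v q)
    (hT : 0 < T) (hν : 0 < ν) (h0 : IsAxisymmetric u₀) (h0' : HasNoSwirl u₀)
    (hL1 : Integrable (angVortQuot u₀)) {b : ℝ} (hb : b ∈ Ioc 0 T) :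
    ∫⁻ x, ENNReal.ofReal (cylRadius x ^ 2 * (angVortQuot (v b) x)⁻) ≤
      (∫⁻ x, ENNReal.ofReal (cylRadius x ^ 2 * (angVortQuot u₀ x)⁻)) +
      ENNReal.ofReal (∫ t in Ioo 0 b, ∫ x, (angVortQuot (v t) x)⁻ *
        (2 * (x 0 * v t x 0 + x 1 * v t x 1))) := by
  obtain ⟨D, -, hD⟩ := Calculus.exists_bound_deriv_smoothTransition
  refine h.lintegral_rsq_comp_angVortQuot_le hT hν h0 h0' hL1
    (βs := fun n w => ∫ r in (0 : ℝ)..(-w), Real.smoothTransition (r / ((1 : ℝ) / (n + 1))))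
    (Ks := fun n => D / ((1 : ℝ) / (n + 1))) continuous_negPart_real' (fun w => negPart_nonneg w)
    (fun w => negPart_le_abs' w)
    (fun n => (contDiff_posApprox' _).comp contDiff_neg) (fun n => by simp) (fun n => ?_)
    (fun n w => ?_) (fun n w => ?_) (fun n w => ?_) (fun w => ?_) hb
  · rw [deriv_negApprox']
    simp [Real.smoothTransition.zero_of_nonpos]
  · rw [deriv_deriv_negApprox']
    exact div_nonneg Real.smoothTransition.monotone.deriv_nonneg (by positivity)
  · rw [deriv_deriv_negApprox']
    exact div_le_div_of_nonneg_right ((le_abs_self _).trans (hD _)) (by positivity)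
  · rw [← posPart_neg]
    exact posApprox_le_posPart' (by positivity) (-w)
  · rw [← posPart_neg]
    exact tendsto_posApprox' (-w)

end Approx

end Literature.Analysis.FluidPDE

end
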